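import Literature.Barriers.ValiantsHypothesis.BILPS19Cor42VerifierSemantics
import Literature.Computability.AlgebraicComplexity.KV20LinearCircuitEquationsProofs
import HarnessLib

/-!
# Kumar–Volk 2020/2022, Cor 1.3 (reduction roster, brick (W), part a): ONE integer circuit for
# `C ∘ Ũ_n` — the universal map for size-`s` linear circuits as an explicit gate list, composed
# with a guessed gate list

Source: M. Kumar, B. L. Volk, *A polynomial degree bound on equations for non-rigid matrices and
small linear circuits*, ACM TOCT 14(2) (2022) art. 6 = arXiv:2003.12938, §4.1 (the universal
circuit for size `s` and the universal map `U(x, y)`, its edge slots labelled by the Shpilka–Volkovich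
map) and §6 (proof of Cor 1.3 = arXiv §5, p0009:L8–13: the `NP` verifier checks by polynomial
identity testing that a guessed circuit `C` satisfies `C ∘ U ≡ 0`). Cell val-lit, roster RULING
(105)/(106) of 2026-08-27 (KV20 `kumarVolk2020_cor_1_3` reduction, census `+0` by design), brick
(W) «FP writers»: this file is its ALGEBRAIC half — the layout and the semantics of the single
division-free integer circuit whose identity test the verifier runs; the string-level writer is the
sibling `KV20UniversalMapWriter.lean`.

* §1 a generic tool: `gateValues_append_of_spec` — the value list of a block of gates appended to
  a prefix is the list of a prescribed value function as soon as every gate of the block evaluates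
  to its prescribed value against the prefix values and the prescribed earlier values of the block.
* §2 the INTEGER universal chart `chart n s` over the `s + s` variables `x_j = var j`, `y_j = var
  (s + j)`: six blocks, each a `List.range`-indexed list of gates (so that the writer is one loop
  per block) — linear factors `y_j − a` (`a < S`, `S = sn + s² + n(n+s)` the number of edge slots,
  `KumarVolk2020.card_uSlot`), Lagrange NUMERATORS `N_a(y_j) = ∏_{a' ≠ a} (y_j − a')` (integer nodes
  `0, …, S − 1` — the denominator-free variant of KV Lemma 3.1 used in the integer setting of §6),
  products `N_a(y_j) · x_j`, the integer Shpilka–Volkovich labels `SV_a = Σ_j N_a(y_j) x_j`, the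
  valuation `ucVal` of the universal circuit (its defining equations `KumarVolk2020.ucVal_eq`, gate by
  gate), and its output matrix `ucOut`; slots are numbered by the explicit formula `slotCode`.
* §3 `univCircuit n s B`: the chart followed by ONE use (`BILPS2019Cor42.useGatesRef`) of a guessed
  gate list `B : KIReduction.KBlock` over `n²` inputs behind the `n²` output gates, and
  **`eval_univCircuit`**: it computes `blockPoly (n·n) B` composed with the integer universal map
  `q ↦ ucOut (svLabel n s) (q / n) (q % n)`.

Theorem-only file with plumbing `def`s (layouts, gate lists, value functions); 0 facts. The bridge
to the polynomial-level integer universal map of the sibling brick (Uℤ) (`KV20UniversalMapInt.lean`,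
x5) is a separate lemma once that file is in the tree. HONEST FRAMING (val-lit): bookkeeping of a
published CONDITIONAL result (PIT ∈ P ⇒ one of two lower bounds); `VP ≠ VNP` is NOT proved and
nothing here bears on it.

## References

* [KumarVolk2022] M. Kumar, B. L. Volk, ACM TOCT 14(2) (2022) art. 6, doi:10.1145/3543685 =
  arXiv:2003.12938 — §4.1 (universal circuit and universal map), Lemma 3.1 (the SV map), §6 /
  arXiv §5 p0009:L8–13 (the verifier's identity test `C ∘ U ≡ 0`).
* [KabanetsImpagliazzo2003] V. Kabanets, R. Impagliazzo, STOC 2003, proof of Cor. 12 (p. 358)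
  (guessed gate lists used behind input layers).
* [Burgisser2000] P. Bürgisser, *Completeness and Reduction in Algebraic Complexity Theory*,
  Springer 2000, Def. 2.1 (straight-line programs), Rem. 2.7 (substitution).
-/

noncomputable section

open MvPolynomial

namespace Literature.Computability.AlgebraicComplexity

namespace KumarVolk2020

namespace UnivCircuit

open ArithCircuit KIReduction Literature.Barriers.ValiantsHypothesis.BILPS2019Cor42

universe u

/-! ### §1. Values of a block of gates with prescribed values -/

section Spec

variable {τ : Type u}

/-- Reading a position of the appended part of a value list (Bürgisser 2000, Def. 2.1: the value
list of a straight-line program). [cite: Burgisser2000, Def. 2.1] -/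
theorem eval_gate_append_right (gs : List (Gate ℤ τ)) (ws : List (MvPolynomial τ ℤ)) (j : ℕ) :
    (Operand.gate (gs.length + j) : Operand ℤ τ).eval (gateValues gs ++ ws) = ws.getD j 0 := by
  simp only [Operand.eval_gate, List.getD_eq_getElem?_getD]
  rw [List.getElem?_append_right (by rw [gateValues_length]; omega), gateValues_length,
    Nat.add_sub_cancel_left]

/-- Reading a prescribed earlier value. [folklore] -/
private theorem getD_map_range {f : ℕ → MvPolynomial τ ℤ} {m j : ℕ} (hj : j < m) :
    ((List.range m).map f).getD j 0 = f j := by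
  rw [List.getD_eq_getElem?_getD, List.getElem?_map, List.getElem?_range hj]
  rfl

/-- **Values of an appended block with prescribed values.** If gate `k` of the block `gs`,
evaluated against the values of the prefix `pre` followed by ANY list of length `k` agreeing with
`f` below `k`, has the value `f k`, then the values of `pre ++ gs` are those of `pre` followed by
`f 0, …, f (|gs| − 1)` (Bürgisser 2000, Def. 2.1: instruction `k` uses only earlier results).
[cite: Burgisser2000, Def. 2.1] -/
theorem gateValues_append_of_spec (pre gs : List (Gate ℤ τ)) (f : ℕ → MvPolynomial τ ℤ)
    (h : ∀ (k : ℕ) (hk : k < gs.length) (ws : List (MvPolynomial τ ℤ)), ws.length = k →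
      (∀ j < k, ws.getD j 0 = f j) → (gs[k]).eval (gateValues pre ++ ws) = f k) :
    gateValues (pre ++ gs) = gateValues pre ++ (List.range gs.length).map f := by
  induction gs using List.reverseRecOn with
  | nil => simp
  | append_singleton gs g ih =>
    have ih' := ih fun k hk ws hws hf => by
      have := h k (by simp; omega) ws hws hf
      rwa [List.getElem_append_left hk] at this
    rw [← List.append_assoc, gateValues_append_singleton, ih', List.length_append,
      List.length_singleton, List.range_succ, List.map_append, List.map_singleton, List.append_assoc]
    have := h gs.length (by simp) ((List.range gs.length).map f) (by simp)
      (fun j hj => getD_map_range hj)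
    rw [show (gs ++ [g])[gs.length] = g by simp] at this
    rw [this]

/-- The empty gate list has no values. [folklore] -/
@[simp] private theorem gateValues_nil : gateValues ([] : List (Gate ℤ τ)) = [] := rfl

/-- A `List.range`-indexed block with prescribed values: gate `k` is `g k` (Bürgisser 2000, Def. 2.1:
instruction `k` uses only earlier results). [cite: Burgisser2000, Def. 2.1] -/
theorem gateValues_append_map_range (pre : List (Gate ℤ τ)) (m : ℕ) (g : ℕ → Gate ℤ τ)
    (f : ℕ → MvPolynomial τ ℤ)
    (h : ∀ k < m, ∀ ws : List (MvPolynomial τ ℤ), ws.length = k →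
      (∀ j < k, ws.getD j 0 = f j) → (g k).eval (gateValues pre ++ ws) = f k) :
    gateValues (pre ++ (List.range m).map g) = gateValues pre ++ (List.range m).map f := by
  have := gateValues_append_of_spec pre ((List.range m).map g) f fun k hk ws hws hf => by
    rw [List.getElem_map, List.getElem_range]
    exact h k (by simpa using hk) ws hws hf
  simpa using this

/-- Reading a value of a `List.range`-indexed block placed after `pre`, inside any extension
(Bürgisser 2000, Def. 2.1). [cite: Burgisser2000, Def. 2.1] -/
theorem valueAt_block (pre post : List (Gate ℤ τ)) (m : ℕ) (g : ℕ → Gate ℤ τ)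
    (f : ℕ → MvPolynomial τ ℤ)
    (hv : gateValues (pre ++ (List.range m).map g) = gateValues pre ++ (List.range m).map f)
    {j : ℕ} (hj : j < m) :
    valueAt (pre ++ (List.range m).map g ++ post) (pre.length + j) = f j := by
  rw [valueAt_append_left _ _ (by simp; omega), valueAt, hv, List.getD_eq_getElem?_getD,
    List.getElem?_append_right (by rw [gateValues_length]; omega), gateValues_length,
    Nat.add_sub_cancel_left, ← List.getD_eq_getElem?_getD, getD_map_range hj]

end Spec

/-! ### §2. The integer universal chart -/

section Layout

variable (n s : ℕ)

/-- Number of edge slots of the universal circuit for size `s`: `S = sn + s² + n(n+s)`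
(`KumarVolk2020.card_uSlot`). [cite: KumarVolk2022, §4.1] -/
def nSlot : ℕ := s * n + (s * s + n * (n + s))

/-- Code of the slot `X_i → t`. [cite: KumarVolk2022, §4.1] -/
def inCode (t i : ℕ) : ℕ := t * n + i

/-- Code of the slot `t' → t`. [cite: KumarVolk2022, §4.1] -/
def ggCode (t t' : ℕ) : ℕ := s * n + (t * s + t')

/-- Code of the slot `X_i → out_j`. [cite: KumarVolk2022, §4.1] -/
def oiCode (j i : ℕ) : ℕ := s * n + s * s + (j * (n + s) + i)

/-- Code of the slot `t → out_j`. [cite: KumarVolk2022, §4.1] -/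
def ogCode (j t : ℕ) : ℕ := s * n + s * s + (j * (n + s) + (n + t))

/-- **The explicit numbering of the edge slots** (an injection `USlot n s → {0, …, S − 1}`; its
values are the integer Lagrange nodes). [cite: KumarVolk2022, §4.1] -/
def slotCode : USlot n s → ℕ
  | .inl (t, i) => inCode n t i
  | .inr (.inl (t, t')) => ggCode n s t t'
  | .inr (.inr (j, .inl i)) => oiCode n s j i
  | .inr (.inr (j, .inr t)) => ogCode n s j t

/-- `inCode < sn`. [folklore] -/
private theorem inCode_lt {t i : ℕ} (ht : t < s) (hi : i < n) : inCode n t i < s * n := by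
  unfold inCode
  calc t * n + i < t * n + n := by omega
    _ = (t + 1) * n := by ring
    _ ≤ s * n := Nat.mul_le_mul_right _ ht

/-- `ggCode < sn + s²`. [folklore] -/
private theorem ggCode_lt {t t' : ℕ} (ht : t < s) (ht' : t' < s) : ggCode n s t t' < s * n + s * s := by
  unfold ggCode
  have : t * s + t' < s * s := by
    calc t * s + t' < t * s + s := by omega
      _ = (t + 1) * s := by ring
      _ ≤ s * s := Nat.mul_le_mul_right _ ht
  omega

/-- `oiCode < S`. [folklore] -/
private theorem oiCode_lt {j i : ℕ} (hj : j < n) (hi : i < n) : oiCode n s j i < nSlot n s := by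
  unfold oiCode nSlot
  have : j * (n + s) + i < n * (n + s) := by
    calc j * (n + s) + i < j * (n + s) + (n + s) := by omega
      _ = (j + 1) * (n + s) := by ring
      _ ≤ n * (n + s) := Nat.mul_le_mul_right _ hj
  omega

/-- `ogCode < S`. [folklore] -/
private theorem ogCode_lt {j t : ℕ} (hj : j < n) (ht : t < s) : ogCode n s j t < nSlot n s := by
  unfold ogCode nSlot
  have : j * (n + s) + (n + t) < n * (n + s) := by
    calc j * (n + s) + (n + t) < j * (n + s) + (n + s) := by omega
      _ = (j + 1) * (n + s) := by ring
      _ ≤ n * (n + s) := Nat.mul_le_mul_right _ hj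
  omega

/-- Every slot code is `< S`. [cite: KumarVolk2022, §4.1] -/
theorem slotCode_lt (e : USlot n s) : slotCode n s e < nSlot n s := by
  rcases e with ⟨t, i⟩ | ⟨t, t'⟩ | ⟨j, i | t⟩
  · have := inCode_lt n s t.isLt i.isLt; unfold nSlot; simp only [slotCode]; omega
  · have := ggCode_lt n s t.isLt t'.isLt; unfold nSlot; simp only [slotCode]; omega
  · exact oiCode_lt n s j.isLt i.isLt
  · exact ogCode_lt n s j.isLt t.isLt

/-! #### Block A: the linear factors `y_j − a` -/

/-- Index of the factor `y_j − a`. [folklore] -/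
def linIdx (j a : ℕ) : ℕ := j * nSlot n s + a

/-- The gate `y_j − a` (`y_j = var (s + j)`). [cite: KumarVolk2022, Lemma 3.1 (proof)] -/
def linGate (r : ℕ) : Gate ℤ (Fin (s + s)) :=
  .sum [(1, varOp (s + s) (s + r / nSlot n s)), (-1, .const (r % nSlot n s : ℕ))]

variable {n} in
/-- Value of the factor gate: `y_j − a`. [cite: KumarVolk2022, Lemma 3.1 (proof)] -/
def linVal (j a : ℕ) : MvPolynomial (Fin (s + s)) ℤ := varP (s + s) (s + j) - C (a : ℤ)

/-- Block A. [cite: KumarVolk2022, Lemma 3.1 (proof)] -/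
def linGates : List (Gate ℤ (Fin (s + s))) := (List.range (s * nSlot n s)).map (linGate n s)

/-! #### Block B: the Lagrange numerators `N_a(y_j) = ∏_{a' ≠ a} (y_j − a')` -/

/-- Start of block B. [folklore] -/
def numBase : ℕ := s * nSlot n s

/-- Index of the numerator `N_a(y_j)`. [folklore] -/
def numIdx (j a : ℕ) : ℕ := numBase n s + (j * nSlot n s + a)

/-- The gate `∏_{a' < S, a' ≠ a} (y_j − a')` (one product gate). [cite: KumarVolk2022, Lemma 3.1 (proof)] -/
def numGate (r : ℕ) : Gate ℤ (Fin (s + s)) :=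
  .prod (((List.range (nSlot n s)).filter fun a' => a' ≠ r % nSlot n s).map
    fun a' => .gate (linIdx n s (r / nSlot n s) a'))

/-- Value of the numerator gate: the integer Lagrange numerator `N_a(y_j)` at the nodes
`0, …, S − 1`. [cite: KumarVolk2022, Lemma 3.1 (proof)] -/
def numVal (j a : ℕ) : MvPolynomial (Fin (s + s)) ℤ :=
  ∏ a' ∈ (Finset.range (nSlot n s)).erase a, linVal s j a'

/-- Block B. [cite: KumarVolk2022, Lemma 3.1 (proof)] -/
def numGates : List (Gate ℤ (Fin (s + s))) := (List.range (s * nSlot n s)).map (numGate n s)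

/-! #### Block C: the integer Shpilka–Volkovich labels `SV_a = Σ_j N_a(y_j) · x_j` -/

/-- Start of block C1. [folklore] -/
def termBase : ℕ := numBase n s + s * nSlot n s

/-- Index of the term `N_a(y_j) · x_j`. [folklore] -/
def termIdx (j a : ℕ) : ℕ := termBase n s + (j * nSlot n s + a)

/-- The gate `N_a(y_j) · x_j` (`x_j = var j`). [cite: KumarVolk2022, Lemma 3.1 (proof)] -/
def termGate (r : ℕ) : Gate ℤ (Fin (s + s)) :=
  .prod [.gate (numIdx n s (r / nSlot n s) (r % nSlot n s)), varOp (s + s) (r / nSlot n s)]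

/-- Value of the term gate. [cite: KumarVolk2022, Lemma 3.1 (proof)] -/
def termVal (j a : ℕ) : MvPolynomial (Fin (s + s)) ℤ := numVal n s j a * varP (s + s) j

/-- Block C1. [cite: KumarVolk2022, Lemma 3.1 (proof)] -/
def termGates : List (Gate ℤ (Fin (s + s))) := (List.range (s * nSlot n s)).map (termGate n s)

/-- Start of block C2. [folklore] -/
def svBase : ℕ := termBase n s + s * nSlot n s

/-- Index of the label gate `SV_a`. [folklore] -/
def svIdx (a : ℕ) : ℕ := svBase n s + a

/-- The gate `SV_a = Σ_{j < s} 1 • (N_a(y_j) · x_j)`. [cite: KumarVolk2022, Lemma 3.1 (proof)] -/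
def svGate (a : ℕ) : Gate ℤ (Fin (s + s)) :=
  .sum ((List.range s).map fun j => ((1 : ℤ), .gate (termIdx n s j a)))

/-- Value of the label gate: the INTEGER Shpilka–Volkovich coordinate `SV_a(x, y) = Σ_j N_a(y_j) x_j`
(Lagrange numerators at the nodes `0, …, S − 1` in place of Lagrange indicators).
[cite: KumarVolk2022, Lemma 3.1 (proof)] -/
def svVal (a : ℕ) : MvPolynomial (Fin (s + s)) ℤ := ∑ j ∈ Finset.range s, termVal n s j a

/-- Block C2. [cite: KumarVolk2022, Lemma 3.1 (proof)] -/
def svGates : List (Gate ℤ (Fin (s + s))) := (List.range (nSlot n s)).map (svGate n s)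

/-- **The integer labelling of the edge slots**: slot `e` carries `SV_{slotCode e}`.
[cite: KumarVolk2022, §4.1 ("The edge e_i is labeled by the i-th coordinate of the map SV")] -/
def svLabel : USlot n s → MvPolynomial (Fin (s + s)) ℤ := fun e => svVal n s (slotCode n s e)

/-! #### Block D: the valuation of the universal circuit -/

/-- Start of block D. [folklore] -/
def valBase : ℕ := svBase n s + nSlot n s

/-- Start of the sub-block of gate slot `t`, input `i` (`s` products, then the value gate). [folklore] -/
def valBlk (t i : ℕ) : ℕ := valBase n s + (t * n + i) * (s + 1)

/-- Index of the gate holding `val(t)_i`. [folklore] -/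
def valIdx (t i : ℕ) : ℕ := valBlk n s t i + s

/-- `val(t)_i` as a total function of `t, i` (junk `0` out of range). [cite: KumarVolk2022, §4.1] -/
def valPoly (t i : ℕ) : MvPolynomial (Fin (s + s)) ℤ :=
  if h : t < s ∧ i < n then ucVal (svLabel n s) ⟨t, h.1⟩ ⟨i, h.2⟩ else 0

/-- Gate `r` of block D (`r = (tn + i)(s+1) + u`): for `u < s` the product `SV_{t' → t} · val(t')_i`
if `u = t' < t` (else the zero gate), for `u = s` the value gate
`1 • SV_{X_i → t} + Σ_{t' < s} 1 • (product t')`. [cite: KumarVolk2022, §4.1] -/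
def valGate (r : ℕ) : Gate ℤ (Fin (s + s)) :=
  if r % (s + 1) < s then
    if r % (s + 1) < r / (s + 1) / n then
      .prod [.gate (svIdx n s (ggCode n s (r / (s + 1) / n) (r % (s + 1)))),
        .gate (valIdx n s (r % (s + 1)) (r / (s + 1) % n))]
    else .sum []
  else .sum (((1 : ℤ), .gate (svIdx n s (inCode n (r / (s + 1) / n) (r / (s + 1) % n)))) ::
    (List.range s).map fun t' => ((1 : ℤ), .gate (valBase n s + r / (s + 1) * (s + 1) + t')))

/-- Prescribed value of gate `r` of block D. [cite: KumarVolk2022, §4.1] -/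
def valVal (r : ℕ) : MvPolynomial (Fin (s + s)) ℤ :=
  if r % (s + 1) < s then
    if r % (s + 1) < r / (s + 1) / n then
      svVal n s (ggCode n s (r / (s + 1) / n) (r % (s + 1))) * valPoly n s (r % (s + 1)) (r / (s + 1) % n)
    else 0
  else valPoly n s (r / (s + 1) / n) (r / (s + 1) % n)

/-- Block D. [cite: KumarVolk2022, §4.1] -/
def valGates : List (Gate ℤ (Fin (s + s))) := (List.range (s * n * (s + 1))).map (valGate n s)

/-! #### Block E: the output matrix of the universal circuit -/

/-- Start of block E. [folklore] -/
def outBase : ℕ := valBase n s + s * n * (s + 1)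

/-- Start of the sub-block of output `j`, input `i`. [folklore] -/
def outBlk (j i : ℕ) : ℕ := outBase n s + (j * n + i) * (s + 1)

/-- Index of the gate holding entry `(j, i)` of the universal map. [folklore] -/
def outIdx (j i : ℕ) : ℕ := outBlk n s j i + s

/-- Entry `(j, i)` of the integer universal map as a total function (junk `0` out of range).
[cite: KumarVolk2022, §4.1] -/
def outPoly (j i : ℕ) : MvPolynomial (Fin (s + s)) ℤ :=
  if h : j < n ∧ i < n then ucOut (svLabel n s) ⟨j, h.1⟩ ⟨i, h.2⟩ else 0

/-- Gate `r` of block E (`r = (jn + i)(s+1) + u`): for `u < s` the product `SV_{u → out_j} · val(u)_i`,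
for `u = s` the entry gate `1 • SV_{X_i → out_j} + Σ_{t < s} 1 • (product t)`. [cite: KumarVolk2022, §4.1] -/
def outGate (r : ℕ) : Gate ℤ (Fin (s + s)) :=
  if r % (s + 1) < s then
    .prod [.gate (svIdx n s (ogCode n s (r / (s + 1) / n) (r % (s + 1)))),
      .gate (valIdx n s (r % (s + 1)) (r / (s + 1) % n))]
  else .sum (((1 : ℤ), .gate (svIdx n s (oiCode n s (r / (s + 1) / n) (r / (s + 1) % n)))) ::
    (List.range s).map fun t => ((1 : ℤ), .gate (outBase n s + r / (s + 1) * (s + 1) + t)))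

/-- Prescribed value of gate `r` of block E. [cite: KumarVolk2022, §4.1] -/
def outVal (r : ℕ) : MvPolynomial (Fin (s + s)) ℤ :=
  if r % (s + 1) < s then
    svVal n s (ogCode n s (r / (s + 1) / n) (r % (s + 1))) * valPoly n s (r % (s + 1)) (r / (s + 1) % n)
  else outPoly n s (r / (s + 1) / n) (r / (s + 1) % n)

/-- Block E. [cite: KumarVolk2022, §4.1] -/
def outGates : List (Gate ℤ (Fin (s + s))) := (List.range (n * n * (s + 1))).map (outGate n s)

/-- **The integer universal chart**: blocks A, B, C1, C2, D, E. [cite: KumarVolk2022, §4.1] -/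
def chart : List (Gate ℤ (Fin (s + s))) :=
  linGates n s ++ numGates n s ++ termGates n s ++ svGates n s ++ valGates n s ++ outGates n s

/-- Length of the chart. [folklore] -/
def chartLen : ℕ := outBase n s + n * n * (s + 1)

/-- The chart has `chartLen` gates (size of a straight-line program, Bürgisser 2000, Def. 2.1). [cite: Burgisser2000, Def. 2.1] -/
@[simp] theorem length_chart : (chart n s).length = chartLen n s := by
  simp only [chart, chartLen, linGates, numGates, termGates, svGates, valGates, outGates, outBase,
    valBase, svBase, termBase, numBase, List.length_append, List.length_map, List.length_range]

end Layout

/-! ### §3. Semantics of the chart -/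

section Semantics

variable (n s : ℕ)

/-- Arithmetic of a two-level index `r = j·S + a`. [folklore] -/
private theorem divmod_lt {r S m : ℕ} (hr : r < m * S) : r / S < m ∧ r % S < S := by
  have hS : 0 < S := Nat.pos_of_ne_zero fun h => by subst h; simp at hr
  exact ⟨(Nat.div_lt_iff_lt_mul hS).2 hr, Nat.mod_lt _ hS⟩

/-- **Block A computes the linear factors.** [cite: KumarVolk2022, Lemma 3.1 (proof)] -/
theorem gateValues_A : gateValues (linGates n s) =
    (List.range (s * nSlot n s)).map fun r => linVal s (r / nSlot n s) (r % nSlot n s) := by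
  have h := gateValues_append_map_range ([] : List (Gate ℤ (Fin (s + s)))) (s * nSlot n s) (linGate n s)
    (fun r => linVal s (r / nSlot n s) (r % nSlot n s)) fun k _ ws _ _ => by
      simp only [linGate, Gate.eval, List.map_cons, List.map_nil, List.sum_cons, List.sum_nil,
        eval_varOp, one_smul, neg_smul, add_zero, linVal, sub_eq_add_neg]
      rfl
  simpa [linGates] using h

/-- Reading a linear factor after block A. [cite: KumarVolk2022, Lemma 3.1 (proof)] -/
theorem valueAt_lin (post : List (Gate ℤ (Fin (s + s)))) {j a : ℕ} (hj : j < s) (ha : a < nSlot n s) :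
    valueAt (linGates n s ++ post) (linIdx n s j a) = linVal s j a := by
  have hlt : j * nSlot n s + a < s * nSlot n s := by
    calc j * nSlot n s + a < j * nSlot n s + nSlot n s := by omega
      _ = (j + 1) * nSlot n s := by ring
      _ ≤ s * nSlot n s := Nat.mul_le_mul_right _ hj
  have h := valueAt_block ([] : List (Gate ℤ (Fin (s + s)))) post (s * nSlot n s) (linGate n s)
    (fun r => linVal s (r / nSlot n s) (r % nSlot n s)) (by simpa [linGates] using gateValues_A n s) hlt
  simp only [List.nil_append, List.length_nil, Nat.zero_add] at h
  rw [linGates, linIdx, h]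
  have hS : 0 < nSlot n s := by omega
  congr 1
  · rw [Nat.add_comm, Nat.add_mul_div_right _ _ hS, Nat.div_eq_of_lt ha, Nat.zero_add]
  · rw [Nat.add_comm, Nat.add_mul_mod_self_right, Nat.mod_eq_of_lt ha]

/-- The numerator gate computes the Finset product. [cite: KumarVolk2022, Lemma 3.1 (proof)] -/
private theorem prod_filter_range_eq (S a : ℕ) (f : ℕ → MvPolynomial (Fin (s + s)) ℤ) :
    (((List.range S).filter fun a' => a' ≠ a).map f).prod = ∏ a' ∈ (Finset.range S).erase a, f a' := by
  have hset : (Finset.range S).erase a = ((List.range S).filter fun a' => a' ≠ a).toFinset := by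
    ext x
    simp [Finset.mem_erase, and_comm]
  rw [hset, List.prod_toFinset _ ((List.nodup_range).filter _)]

/-- **Block B computes the Lagrange numerators.** [cite: KumarVolk2022, Lemma 3.1 (proof)] -/
theorem gateValues_B : gateValues (linGates n s ++ numGates n s) = gateValues (linGates n s) ++
    (List.range (s * nSlot n s)).map fun r => numVal n s (r / nSlot n s) (r % nSlot n s) := by
  have h := gateValues_append_map_range (linGates n s) (s * nSlot n s) (numGate n s)
    (fun r => numVal n s (r / nSlot n s) (r % nSlot n s)) fun k hk ws _ _ => by
      obtain ⟨hj, ha⟩ := divmod_lt (S := nSlot n s) hk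
      simp only [numGate, Gate.eval, List.map_map, Function.comp_def, numVal]
      rw [← prod_filter_range_eq]
      refine congrArg List.prod (List.map_congr_left fun a' ha' => ?_)
      have ha'' : a' < nSlot n s := List.mem_range.1 (List.mem_filter.1 ha').1
      rw [eval_gate_append _ _ (by
        simp only [linGates, List.length_map, List.length_range, linIdx]
        calc k / nSlot n s * nSlot n s + a' < k / nSlot n s * nSlot n s + nSlot n s := by omega
          _ = (k / nSlot n s + 1) * nSlot n s := by ring
          _ ≤ s * nSlot n s := Nat.mul_le_mul_right _ hj)]
      have := valueAt_lin n s [] hj ha''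
      rwa [List.append_nil] at this
  simpa [numGates] using h

/-- Reading a numerator after block B. [cite: KumarVolk2022, Lemma 3.1 (proof)] -/
theorem valueAt_num (post : List (Gate ℤ (Fin (s + s)))) {j a : ℕ} (hj : j < s) (ha : a < nSlot n s) :
    valueAt (linGates n s ++ numGates n s ++ post) (numIdx n s j a) = numVal n s j a := by
  have hlt : j * nSlot n s + a < s * nSlot n s := by
    calc j * nSlot n s + a < j * nSlot n s + nSlot n s := by omega
      _ = (j + 1) * nSlot n s := by ring
      _ ≤ s * nSlot n s := Nat.mul_le_mul_right _ hj
  have h := valueAt_block (linGates n s) post (s * nSlot n s) (numGate n s)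
    (fun r => numVal n s (r / nSlot n s) (r % nSlot n s)) (by simpa [numGates] using gateValues_B n s) hlt
  rw [numGates, numIdx, numBase,
    show s * nSlot n s + (j * nSlot n s + a) = (linGates n s).length + (j * nSlot n s + a) by
      simp [linGates], h]
  have hS : 0 < nSlot n s := by omega
  congr 1
  · rw [Nat.add_comm, Nat.add_mul_div_right _ _ hS, Nat.div_eq_of_lt ha, Nat.zero_add]
  · rw [Nat.add_comm, Nat.add_mul_mod_self_right, Nat.mod_eq_of_lt ha]

/-- Arithmetic of `a·c + b` with `b < c`. [folklore] -/
private theorem divmod_eq (a : ℕ) {b c : ℕ} (hb : b < c) : (a * c + b) / c = a ∧ (a * c + b) % c = b := by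
  have hc : 0 < c := by omega
  constructor
  · rw [Nat.add_comm, Nat.add_mul_div_right _ _ hc, Nat.div_eq_of_lt hb, Nat.zero_add]
  · rw [Nat.add_comm, Nat.add_mul_mod_self_right, Nat.mod_eq_of_lt hb]

/-- A two-level index below `m·S` with first component `< m`. [folklore] -/
private theorem idx_lt {j a m S : ℕ} (hj : j < m) (ha : a < S) : j * S + a < m * S := by
  calc j * S + a < j * S + S := by omega
    _ = (j + 1) * S := by ring
    _ ≤ m * S := Nat.mul_le_mul_right _ hj

/-- List sums over `List.range` are Finset sums. [folklore] -/
private theorem sum_map_range {M : Type*} [AddCommMonoid M] (f : ℕ → M) (m : ℕ) :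
    ((List.range m).map f).sum = ∑ i ∈ Finset.range m, f i := by
  rw [← List.toFinset_range, List.sum_toFinset _ List.nodup_range]

/-! #### Block C -/

/-- The gates before block C1. [folklore] -/
def chartB : List (Gate ℤ (Fin (s + s))) := linGates n s ++ numGates n s

/-- `|chartB| = termBase`. [folklore] -/
@[simp] private theorem length_chartB : (chartB n s).length = termBase n s := by
  simp only [chartB, linGates, numGates, termBase, numBase, List.length_append, List.length_map,
    List.length_range]

/-- **Block C1 computes the terms `N_a(y_j) · x_j`.** [cite: KumarVolk2022, Lemma 3.1 (proof)] -/
theorem gateValues_C1 : gateValues (chartB n s ++ termGates n s) = gateValues (chartB n s) ++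
    (List.range (s * nSlot n s)).map fun r => termVal n s (r / nSlot n s) (r % nSlot n s) := by
  have h := gateValues_append_map_range (chartB n s) (s * nSlot n s) (termGate n s)
    (fun r => termVal n s (r / nSlot n s) (r % nSlot n s)) fun k hk ws _ _ => by
      obtain ⟨hj, ha⟩ := divmod_lt (S := nSlot n s) hk
      have hidx : numIdx n s (k / nSlot n s) (k % nSlot n s) < (chartB n s).length := by
        rw [length_chartB, termBase, numIdx]
        have := idx_lt hj ha
        omega
      simp only [termGate, Gate.eval, List.map_cons, List.map_nil, List.prod_cons, List.prod_nil, mul_one,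
        eval_varOp, eval_gate_append _ _ hidx, termVal]
      have := valueAt_num n s [] hj ha
      rw [List.append_nil, ← chartB] at this
      rw [this]
  simpa [termGates] using h

/-- Reading a term after block C1. [cite: KumarVolk2022, Lemma 3.1 (proof)] -/
theorem valueAt_term (post : List (Gate ℤ (Fin (s + s)))) {j a : ℕ} (hj : j < s) (ha : a < nSlot n s) :
    valueAt (chartB n s ++ termGates n s ++ post) (termIdx n s j a) = termVal n s j a := by
  have h := valueAt_block (chartB n s) post (s * nSlot n s) (termGate n s)
    (fun r => termVal n s (r / nSlot n s) (r % nSlot n s)) (by simpa [termGates] using gateValues_C1 n s)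
    (idx_lt hj ha)
  rw [termGates, termIdx, show termBase n s + (j * nSlot n s + a) = (chartB n s).length + (j * nSlot n s + a) by
    rw [length_chartB], h, (divmod_eq j ha).1, (divmod_eq j ha).2]

/-- The gates before block C2. [folklore] -/
def chartC : List (Gate ℤ (Fin (s + s))) := chartB n s ++ termGates n s

/-- `|chartC| = svBase`. [folklore] -/
@[simp] private theorem length_chartC : (chartC n s).length = svBase n s := by
  simp only [chartC, termGates, svBase, List.length_append, length_chartB, List.length_map, List.length_range]

/-- **Block C2 computes the integer SV labels.** [cite: KumarVolk2022, Lemma 3.1 (proof)] -/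
theorem gateValues_C2 : gateValues (chartC n s ++ svGates n s) = gateValues (chartC n s) ++
    (List.range (nSlot n s)).map (svVal n s) := by
  have h := gateValues_append_map_range (chartC n s) (nSlot n s) (svGate n s) (svVal n s)
    fun a ha ws _ _ => by
      simp only [svGate, Gate.eval, List.map_map, Function.comp_def, one_smul, svVal]
      rw [← sum_map_range]
      refine congrArg List.sum (List.map_congr_left fun j hj => ?_)
      have hj' : j < s := List.mem_range.1 hj
      rw [eval_gate_append _ _ (by rw [length_chartC, svBase, termIdx]; have := idx_lt hj' ha; omega)]
      have := valueAt_term n s [] hj' ha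
      rwa [List.append_nil] at this
  simpa [svGates] using h

/-- The gates before block D. [folklore] -/
def chartD : List (Gate ℤ (Fin (s + s))) := chartC n s ++ svGates n s

/-- `|chartD| = valBase`. [folklore] -/
@[simp] private theorem length_chartD : (chartD n s).length = valBase n s := by
  simp only [chartD, svGates, valBase, List.length_append, length_chartC, List.length_map, List.length_range]

/-- **Reading a label**: after block C2, gate `svIdx a` holds `SV_a`. [cite: KumarVolk2022, §4.1] -/
theorem valueAt_sv (post : List (Gate ℤ (Fin (s + s)))) {a : ℕ} (ha : a < nSlot n s) :
    valueAt (chartD n s ++ post) (svIdx n s a) = svVal n s a := by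
  have h := valueAt_block (chartC n s) post (nSlot n s) (svGate n s) (svVal n s) (gateValues_C2 n s) ha
  rw [length_chartC] at h
  rw [chartD, svGates, svIdx]
  exact h

/-! #### Block D -/

/-- The slot `t*n + i` decoded. [folklore] -/
private theorem blk_lt {blk m n' : ℕ} (h : blk < m * n') : blk / n' < m ∧ blk % n' < n' ∧ 0 < n' := by
  have hn : 0 < n' := Nat.pos_of_ne_zero fun h0 => by subst h0; simp at h
  exact ⟨(Nat.div_lt_iff_lt_mul hn).2 h, Nat.mod_lt _ hn, hn⟩

/-- `valPoly` in range is `ucVal`. [cite: KumarVolk2022, §4.1] -/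
theorem valPoly_eq {t i : ℕ} (ht : t < s) (hi : i < n) :
    valPoly n s t i = ucVal (svLabel n s) ⟨t, ht⟩ ⟨i, hi⟩ := by
  rw [valPoly, dif_pos ⟨ht, hi⟩]

/-- **The defining equation of `val(t)_i`** in the shape of the value gate: over `t' < s` in a list.
[cite: KumarVolk2022, §4.1] -/
theorem valPoly_rec {t i : ℕ} (ht : t < s) (hi : i < n) :
    valPoly n s t i = svVal n s (inCode n t i) +
      ((List.range s).map fun t' => if t' < t then svVal n s (ggCode n s t t') * valPoly n s t' i else 0).sum := by
  rw [valPoly_eq n s ht hi, ucVal_eq, sum_map_range, ← Fin.sum_univ_eq_sum_range]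
  congr 1
  refine Finset.sum_congr rfl fun t' _ => ?_
  have hiff : (t' < (⟨t, ht⟩ : Fin s)) ↔ t'.val < t := Fin.lt_def
  by_cases h : t'.val < t
  · rw [if_pos (hiff.2 h), if_pos h, valPoly_eq n s t'.isLt hi]; rfl
  · rw [if_neg (fun h' => h (hiff.1 h')), if_neg h]

/-- **Block D computes the valuation of the universal circuit.** [cite: KumarVolk2022, §4.1] -/
theorem gateValues_D : gateValues (chartD n s ++ valGates n s) = gateValues (chartD n s) ++
    (List.range (s * n * (s + 1))).map (valVal n s) := by
  have h := gateValues_append_map_range (chartD n s) (s * n * (s + 1)) (valGate n s) (valVal n s)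
    fun k hk ws hws hf => by
      -- decode `k = blk (s+1) + u`, `blk = t n + i`
      obtain ⟨hblk, hu⟩ := divmod_lt (S := s + 1) hk
      obtain ⟨ht, hi, hn⟩ := blk_lt hblk
      have hk_eq : k = k / (s + 1) * (s + 1) + k % (s + 1) := (Nat.div_add_mod' k (s + 1)).symm
      have hblk_eq : k / (s + 1) = k / (s + 1) / n * n + k / (s + 1) % n := (Nat.div_add_mod' _ n).symm
      by_cases hus : k % (s + 1) < s
      · by_cases hut : k % (s + 1) < k / (s + 1) / n
        · -- the product `SV_{u → t} · val(u)_i`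
          have hsv : svIdx n s (ggCode n s (k / (s + 1) / n) (k % (s + 1))) < (chartD n s).length := by
            rw [length_chartD, valBase, svIdx]
            have := ggCode_lt n s ht (lt_trans hut ht)
            have : s * n + s * s ≤ nSlot n s := by unfold nSlot; omega
            omega
          -- position of `val(u)_i` inside the block, below `k`
          set j := (k % (s + 1) * n + k / (s + 1) % n) * (s + 1) + s with hj
          have hjk : j < k := by
            have h1 : (k % (s + 1) + 1) * n ≤ k / (s + 1) / n * n := Nat.mul_le_mul_right _ hut
            rw [Nat.add_one_mul] at h1
            have h2 : k % (s + 1) * n + k / (s + 1) % n + 1 ≤ k / (s + 1) := by omega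
            have h3 : (k % (s + 1) * n + k / (s + 1) % n + 1) * (s + 1) ≤ k / (s + 1) * (s + 1) :=
              Nat.mul_le_mul_right _ h2
            rw [Nat.add_one_mul] at h3
            omega
          have hjdec := divmod_eq (k % (s + 1) * n + k / (s + 1) % n) (Nat.lt_succ_self s)
          have hjdec' := divmod_eq (k % (s + 1)) hi
          have hvj : valVal n s j = valPoly n s (k % (s + 1)) (k / (s + 1) % n) := by
            rw [valVal, hjdec.2, if_neg (lt_irrefl s), hjdec.1, hjdec'.1, hjdec'.2]
          rw [valGate, if_pos hus, if_pos hut, valVal, if_pos hus, if_pos hut]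
          simp only [Gate.eval, List.map_cons, List.map_nil, List.prod_cons, List.prod_nil, mul_one,
            eval_gate_append _ _ hsv]
          have e1 : valueAt (chartD n s) (svIdx n s (ggCode n s (k / (s + 1) / n) (k % (s + 1)))) =
              svVal n s (ggCode n s (k / (s + 1) / n) (k % (s + 1))) := by
            have := valueAt_sv n s [] (a := ggCode n s (k / (s + 1) / n) (k % (s + 1)))
              (by have := ggCode_lt n s ht (lt_trans hut ht); unfold nSlot; omega)
            rwa [List.append_nil] at this
          rw [valIdx, valBlk, ← length_chartD, show (chartD n s).length +
              (k % (s + 1) * n + k / (s + 1) % n) * (s + 1) + s = (chartD n s).length + j by rw [hj]; ring,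
            eval_gate_append_right, hf j hjk, hvj, e1]
        · rw [valGate, if_pos hus, if_neg hut, valVal, if_pos hus, if_neg hut]
          simp [Gate.eval]
      · -- the value gate: `u = s`
        have hus' : k % (s + 1) = s := by omega
        rw [valGate, if_neg hus, valVal, if_neg hus, valPoly_rec n s ht hi]
        simp only [Gate.eval, List.map_cons, List.map_map, Function.comp_def, List.sum_cons, one_smul]
        refine congrArg₂ (· + ·) ?_ ?_
        · rw [eval_gate_append _ _ (by
            rw [length_chartD, valBase, svIdx]; have := inCode_lt n s ht hi; unfold nSlot; omega)]
          have := valueAt_sv n s [] (a := inCode n (k / (s + 1) / n) (k / (s + 1) % n))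
            (by have := inCode_lt n s ht hi; unfold nSlot; omega)
          rwa [List.append_nil] at this
        · refine congrArg List.sum (List.map_congr_left fun t' ht' => ?_)
          have ht'' : t' < s := List.mem_range.1 ht'
          have hjk : k / (s + 1) * (s + 1) + t' < k := by omega
          rw [← length_chartD, Nat.add_assoc, eval_gate_append_right, hf _ hjk, valVal,
            (divmod_eq (k / (s + 1)) (Nat.lt_succ_of_lt ht'')).1, (divmod_eq (k / (s + 1)) (Nat.lt_succ_of_lt ht'')).2,
            if_pos ht'']
  simpa [valGates] using h

/-- The gates before block E. [folklore] -/
def chartE : List (Gate ℤ (Fin (s + s))) := chartD n s ++ valGates n s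

/-- `|chartE| = outBase`. [folklore] -/
@[simp] private theorem length_chartE : (chartE n s).length = outBase n s := by
  simp only [chartE, valGates, outBase, List.length_append, length_chartD, List.length_map, List.length_range]

/-- **Reading the valuation**: after block D, gate `valIdx t i` holds `val(t)_i`. [cite: KumarVolk2022, §4.1] -/
theorem valueAt_val (post : List (Gate ℤ (Fin (s + s)))) {t i : ℕ} (ht : t < s) (hi : i < n) :
    valueAt (chartE n s ++ post) (valIdx n s t i) = valPoly n s t i := by
  have hlt : (t * n + i) * (s + 1) + s < s * n * (s + 1) := by
    have : t * n + i < s * n := by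
      calc t * n + i < t * n + n := by omega
        _ = (t + 1) * n := by ring
        _ ≤ s * n := Nat.mul_le_mul_right _ ht
    nlinarith
  have h := valueAt_block (chartD n s) post (s * n * (s + 1)) (valGate n s) (valVal n s) (gateValues_D n s) hlt
  rw [length_chartD] at h
  rw [chartE, valGates, valIdx, valBlk, Nat.add_assoc, h, valVal, (divmod_eq (t * n + i) (Nat.lt_succ_self s)).2,
    if_neg (lt_irrefl s), (divmod_eq (t * n + i) (Nat.lt_succ_self s)).1, (divmod_eq t hi).1, (divmod_eq t hi).2]

/-! #### Block E -/

/-- `outPoly` in range is `ucOut`. [cite: KumarVolk2022, §4.1] -/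
theorem outPoly_eq {j i : ℕ} (hj : j < n) (hi : i < n) :
    outPoly n s j i = ucOut (svLabel n s) ⟨j, hj⟩ ⟨i, hi⟩ := by
  rw [outPoly, dif_pos ⟨hj, hi⟩]

/-- **Entry `(j, i)` of the universal map** in the shape of the entry gate. [cite: KumarVolk2022, §4.1] -/
theorem outPoly_rec {j i : ℕ} (hj : j < n) (hi : i < n) :
    outPoly n s j i = svVal n s (oiCode n s j i) +
      ((List.range s).map fun t => svVal n s (ogCode n s j t) * valPoly n s t i).sum := by
  rw [outPoly_eq n s hj hi, ucOut, sum_map_range, ← Fin.sum_univ_eq_sum_range]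
  congr 1
  refine Finset.sum_congr rfl fun t _ => ?_
  rw [valPoly_eq n s t.isLt hi]; rfl

/-- **Block E computes the output matrix of the universal circuit.** [cite: KumarVolk2022, §4.1] -/
theorem gateValues_E : gateValues (chartE n s ++ outGates n s) = gateValues (chartE n s) ++
    (List.range (n * n * (s + 1))).map (outVal n s) := by
  have h := gateValues_append_map_range (chartE n s) (n * n * (s + 1)) (outGate n s) (outVal n s)
    fun k hk ws hws hf => by
      obtain ⟨hblk, hu⟩ := divmod_lt (S := s + 1) hk
      obtain ⟨hj, hi, hn⟩ := blk_lt hblk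
      have hk_eq : k = k / (s + 1) * (s + 1) + k % (s + 1) := (Nat.div_add_mod' k (s + 1)).symm
      by_cases hus : k % (s + 1) < s
      · have hsv : svIdx n s (ogCode n s (k / (s + 1) / n) (k % (s + 1))) < (chartE n s).length := by
          rw [length_chartE, outBase, valBase, svIdx]
          have := ogCode_lt n s hj hus
          omega
        have hvl : valIdx n s (k % (s + 1)) (k / (s + 1) % n) < (chartE n s).length := by
          rw [length_chartE, outBase, valIdx, valBlk]
          have : k % (s + 1) * n + k / (s + 1) % n < s * n := by
            calc k % (s + 1) * n + k / (s + 1) % n < k % (s + 1) * n + n := by omega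
              _ = (k % (s + 1) + 1) * n := by ring
              _ ≤ s * n := Nat.mul_le_mul_right _ hus
          nlinarith
        rw [outGate, if_pos hus, outVal, if_pos hus]
        simp only [Gate.eval, List.map_cons, List.map_nil, List.prod_cons, List.prod_nil, mul_one,
          eval_gate_append _ _ hsv, eval_gate_append _ _ hvl]
        have e1 : valueAt (chartE n s) (svIdx n s (ogCode n s (k / (s + 1) / n) (k % (s + 1)))) =
            svVal n s (ogCode n s (k / (s + 1) / n) (k % (s + 1))) := by
          have := valueAt_sv n s (valGates n s) (a := ogCode n s (k / (s + 1) / n) (k % (s + 1)))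
            (ogCode_lt n s hj hus)
          rwa [← chartE] at this
        have e2 : valueAt (chartE n s) (valIdx n s (k % (s + 1)) (k / (s + 1) % n)) =
            valPoly n s (k % (s + 1)) (k / (s + 1) % n) := by
          have := valueAt_val n s [] hus hi; rwa [List.append_nil] at this
        rw [e1, e2]
      · have hus' : k % (s + 1) = s := by omega
        rw [outGate, if_neg hus, outVal, if_neg hus, outPoly_rec n s hj hi]
        simp only [Gate.eval, List.map_cons, List.map_map, Function.comp_def, List.sum_cons, one_smul]
        refine congrArg₂ (· + ·) ?_ ?_
        · rw [eval_gate_append _ _ (by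
            rw [length_chartE, outBase, valBase, svIdx]; have := oiCode_lt n s hj hi; omega)]
          have := valueAt_sv n s (valGates n s) (a := oiCode n s (k / (s + 1) / n) (k / (s + 1) % n))
            (oiCode_lt n s hj hi)
          rwa [← chartE] at this
        · refine congrArg List.sum (List.map_congr_left fun t ht => ?_)
          have ht' : t < s := List.mem_range.1 ht
          have hjk : k / (s + 1) * (s + 1) + t < k := by omega
          rw [← length_chartE, Nat.add_assoc, eval_gate_append_right, hf _ hjk, outVal,
            (divmod_eq (k / (s + 1)) (Nat.lt_succ_of_lt ht')).1, (divmod_eq (k / (s + 1)) (Nat.lt_succ_of_lt ht')).2,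
            if_pos ht']
  simpa [outGates] using h

/-- The chart is `chartE` followed by block E. [folklore] -/
private theorem chart_eq : chart n s = chartE n s ++ outGates n s := by
  simp [chart, chartE, chartD, chartC, chartB]

/-- **Reading an entry**: in the chart, gate `outIdx j i` holds entry `(j, i)` of the integer
universal map. [cite: KumarVolk2022, §4.1] -/
theorem valueAt_out (post : List (Gate ℤ (Fin (s + s)))) {j i : ℕ} (hj : j < n) (hi : i < n) :
    valueAt (chart n s ++ post) (outIdx n s j i) = outPoly n s j i := by
  have hlt : (j * n + i) * (s + 1) + s < n * n * (s + 1) := by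
    have : j * n + i < n * n := by
      calc j * n + i < j * n + n := by omega
        _ = (j + 1) * n := by ring
        _ ≤ n * n := Nat.mul_le_mul_right _ hj
    nlinarith
  have h := valueAt_block (chartE n s) post (n * n * (s + 1)) (outGate n s) (outVal n s) (gateValues_E n s) hlt
  rw [length_chartE] at h
  rw [chart_eq, outGates, outIdx, outBlk, Nat.add_assoc, h, outVal, (divmod_eq (j * n + i) (Nat.lt_succ_self s)).2,
    if_neg (lt_irrefl s), (divmod_eq (j * n + i) (Nat.lt_succ_self s)).1, (divmod_eq j hi).1, (divmod_eq j hi).2]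

end Semantics

/-! ### §4. The circuit `C ∘ Ũ_n`: the chart and one use of the guessed gate list -/

section Circuit

variable (n s : ℕ)

/-- The output gate of coordinate `q = j·n + i` of the universal map. [folklore] -/
def coordRef (q : ℕ) : ℕ := outIdx n s (q / n) (q % n)

/-- Every coordinate gate lies inside the chart. [folklore] -/
private theorem coordRef_lt {q : ℕ} (hq : q < n * n) : coordRef n s q < chartLen n s := by
  obtain ⟨hj, hi, hn⟩ := blk_lt (m := n) (n' := n) hq
  rw [coordRef, chartLen, outIdx, outBlk]
  have : q / n * n + q % n < n * n := by rw [Nat.div_add_mod' q n]; exact hq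
  nlinarith

/-- **The integer circuit `C ∘ Ũ_n`** for a guessed gate list `C = B` over `n²` inputs: the
universal chart, then one use of `B` behind the `n²` output gates (input `q = j·n + i` of the block
reads entry `(j, i)`); output = the output of the use. [cite: KumarVolk2022, §6 (proof of Cor. 1.3: "C ∘ U ≡ 0")] -/
def univCircuit (B : KBlock) : ArithCircuit ℤ (Fin (s + s)) where
  gates := chart n s ++ useGatesRef (chartLen n s) (coordRef n s) (n * n) B
  output := .gate (chartLen n s + useOut (n * n) B)

/-- Size of `univCircuit`: the chart plus the use. [cite: Burgisser2000, Def. 2.1] -/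
theorem size_univCircuit (B : KBlock) :
    (univCircuit n s B).size = chartLen n s + (n * n + B.length + 1) := by
  simp [univCircuit, ArithCircuit.size]

/-- **Semantics of `C ∘ Ũ_n`.** The circuit computes the polynomial of the guessed gate list
composed with the integer universal map: `blockPoly (n·n) B` at `q ↦ ucOut (svLabel n s) (q / n) (q % n)`.
[cite: KumarVolk2022, §6 (proof of Cor. 1.3)] -/
theorem eval_univCircuit (B : KBlock) :
    (univCircuit n s B).eval =
      aeval (fun q : Fin (n * n) => ucOut (svLabel n s) (finDiv q) (finMod q)) (blockPoly (n * n) B) := by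
  have hfun : (fun q : Fin (n * n) => valueAt (chart n s) (coordRef n s q)) =
      fun q : Fin (n * n) => ucOut (svLabel n s) (finDiv q) (finMod q) := by
    funext q
    have hn := pos_of_fin q
    have hj : q.val / n < n := (Nat.div_lt_iff_lt_mul hn).2 q.isLt
    have hi : q.val % n < n := Nat.mod_lt _ hn
    rw [← List.append_nil (chart n s), coordRef, valueAt_out n s [] hj hi, outPoly_eq n s hj hi]
    rfl
  rw [ArithCircuit.eval, univCircuit, eval_gate_eq_valueAt, ← length_chart,
    ← List.append_nil (chart n s ++ useGatesRef _ _ _ _), valueAt_useGatesRef (chart n s) [] (fun q hq => by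
      rw [length_chart]; exact coordRef_lt n s hq) B, hfun]

end Circuit


end UnivCircuit

end KumarVolk2020

end Literature.Computability.AlgebraicComplexity
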